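import Summits.ValiantsHypothesis.ValiantsHypothesis.Theorems.KPlusLogSqLawTropicalGradedWalkDomXGlue2
import Summits.ValiantsHypothesis.ValiantsHypothesis.Theorems.KPlusLogSqLawTropicalGradedWalkDomXGlue3
import Summits.ValiantsHypothesis.ValiantsHypothesis.Theorems.KPlusLogSqLawTropicalGradedWalkDomXGlue4
import Summits.ValiantsHypothesis.ValiantsHypothesis.Theorems.KPlusLogSqLawTropicalGradedWalkDomXGlue5
import Summits.ValiantsHypothesis.ValiantsHypothesis.Theorems.KPlusLogSqLawTropicalGradedWalkDomXGlue6
import Summits.ValiantsHypothesis.ValiantsHypothesis.Theorems.KPlusLogSqLawTropicalGradedWalkDomXGlue7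

/-!
# Dominance of the excursion states (type X)

GRW-lite `K = 4` graded-walk family (census side of the tropical root law, all `m`):
dominance glue for the EXCURSION states `(w, u, 1)`, `2 ≤ u ≤ w − 1 < m − 1`, of the design typed in
`KPlusLogSqLawTropicalGradedWalkDefs`.  The slack of every rival cell against the row potential `UX`
(file `…PotX`) was certified family by family in `…DomX1` – `…DomX14`; the files `…DomXGlue2` – `…DomXGlue7`
dispatch an arbitrary rival `(a, b, l)` to its family, one file per column type (`b ≤ u − 2`, `b = u − 1`,
`b = u`, `b = u + 1`, `u + 2 ≤ b < w`, `b ≥ w`); this file assembles them into `IsDominant` via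
`isDominant_of_scaledPotential` (scale `1`).

Honest framing: this is a census-side (lower-bound) construction — a quadratic family of
distinct optimal slopes for `TropRootLawAt (n+1) 4`.  It says nothing about `TropicalB` inside
its window and nothing about VP ≠ VNP.

Main result of this part: `isDominant_X` — every excursion state `(w, u, 1)` with `2 ≤ u < w ≤ n` is the unique
optimal assignment at its slope `theta n w u 1` for the weights `vv n`, degrees `dd n`, signs/presence `ee n`.
(The excursion states with `u = 1` have a different potential, `UX1` of `…PotX`, and are not treated here.)
-/

set_option linter.dupNamespace false
set_option autoImplicit false

namespace Summit.ValiantsHypothesis.ValiantsHypothesis.Theorems.LacunarySymmetroidMatrixDescartes.TropicalCensus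

namespace GradedWalk

open Summit.ValiantsHypothesis.ValiantsHypothesis.Theorems.MatrixDescartes.Negative

variable (n : ℕ)

/-! ### the dominance theorem for the excursion states `(w, u, 1)`, `2 ≤ u`, of the phases `w < m` -/

/-- the intended incidences of an excursion state are present. -/
theorem present_X (w u : ℕ) (hu2 : 2 ≤ u) (huw : u < w) (hwn : w ≤ n) (i : Fin (n + 1)) :
    ee n (perm n w u 1 i) i (lam n w u 1 i) ≠ 0 := by
  have hw1 : w ≤ n + 1 := by omega
  rw [lam_X n huw]
  by_cases hwi : w ≤ (i : ℕ)
  · rw [if_pos hwi]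
    have hr := sigmaX_wrap n huw (by omega) hwn i hwi
    have hup : ((perm n w u 1 i : Fin (n + 1)) : ℕ) < (i : ℕ) := by rw [hr]; omega
    exact ee_upper_zero_ne n hup
  · rw [if_neg hwi]
    by_cases h1 : (i : ℕ) + 1 < u
    · rw [if_pos h1]
      have hr := sigmaX_blk n huw hw1 i (by omega) (by omega) (by omega)
      have hlow : (i : ℕ) < ((perm n w u 1 i : Fin (n + 1)) : ℕ) := by rw [hr]; omega
      exact ee_lower_ne n hlow 2 (by decide)
    · rw [if_neg h1]
      by_cases h2 : (i : ℕ) < u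
      · rw [if_pos h2]
        have hr := sigmaX_um1 n huw hw1 i (by omega)
        have hlow : (i : ℕ) < ((perm n w u 1 i : Fin (n + 1)) : ℕ) := by rw [hr]; omega
        exact ee_lower_ne n hlow 3 (by decide)
      · rw [if_neg h2]
        by_cases h3 : (i : ℕ) = u
        · have hr := sigmaX_u n huw hwn i h3
          rcases Nat.lt_or_ge (i : ℕ) ((perm n w u 1 i : Fin (n + 1)) : ℕ) with hlow | hge
          · exact ee_lower_ne n hlow 1 (by decide)
          · exact ee_diag_ne n (show ((perm n w u 1 i : Fin (n + 1)) : ℕ) = (i : ℕ) by omega) 1 (by decide)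
        · have hr := sigmaX_blk n huw hw1 i (by omega) (by omega) h3
          have hlow : (i : ℕ) < ((perm n w u 1 i : Fin (n + 1)) : ℕ) := by rw [hr]; omega
          exact ee_lower_ne n hlow 1 (by decide)

/-- **The excursion state `(w, u, 1)`, `2 ≤ u < w < m`, of the GRW-lite design is the unique optimum at its slope.** -/
theorem isDominant_X (w u : ℕ) (hu2 : 2 ≤ u) (huw : u < w) (hwn : w ≤ n) :
    IsDominant (dd n) (vv n) (ee n) (theta n w u 1) (cterm n w u 1) := by
  rw [theta_X n huw (by omega)]
  unfold cterm
  refine isDominant_of_scaledPotential (dd n) (vv n) (ee n) (thX n w u) (perm n w u 1) (lam n w u 1) 1 one_pos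
    (fun a => UX n w u a)
    (fun b => (thX n w u * (dd n (lam n w u 1 b) : ℤ) - vv n (perm n w u 1 b) b (lam n w u 1 b)) - UX n w u (perm n w u 1 b)) ?_ ?_ ?_
  · -- presence of the intended incidences
    exact present_X n w u hu2 huw hwn
  · -- tightness (by definition of the column potential)
    intro i; ring
  · -- slack
    intro a b l hp hne
    by_cases hwb : w ≤ (b : ℕ)
    · exact slackX_wc n w u hu2 huw hwn a b l hp hne hwb
    · have hbw : (b : ℕ) < w := Nat.lt_of_not_le hwb
      rcases Nat.lt_or_ge ((b : ℕ) + 1) u with h1 | h1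
      · exact slackX_lt n w u hu2 huw hwn a b l hp hne (by omega)
      · rcases Nat.lt_or_ge (b : ℕ) u with h2 | h2
        · exact slackX_um1 n w u hu2 huw hwn a b l hp hne (by omega)
        · rcases Nat.lt_or_ge (u + 1) (b : ℕ) with h3 | h3
          · exact slackX_ge n w u hu2 huw hwn a b l hp hne (by omega) hbw
          · rcases Nat.lt_or_ge u (b : ℕ) with h4 | h4
            · exact slackX_P n w u hu2 huw hwn a b l hp hne (by omega) hbw
            · exact slackX_u n w u hu2 huw hwn a b l hp hne (by omega)

end GradedWalk

end Summit.ValiantsHypothesis.ValiantsHypothesis.Theorems.LacunarySymmetroidMatrixDescartes.TropicalCensus
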